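import Summits.HodgeConjecture.HodgeConjecture.Theorems.Ring2AbelianAllAndreTwistedSquareTwoWeights
import HarnessLib

/-!
# Ring 2 · AbelianAll — ANDRÉ AXIS, PART Q-b: THE EVEN NON-SPLIT ANCHORS — the twisted square of `T = P × E` polarized by
  `(h_P ⊞ η) ⊠ (h_P ⊞ mη)` has discriminant class `[m]`; every polarized component `(2j+2, d, δ)`, `δ > 0`, contains
  `E₀^{2j+2} × Ē₀^{2j+2}` satisfying the Hodge conjecture; parity-free: so does every right-sign component with `n ≥ 2`

HONEST FRAMING (sub-cell `pub-hodge-ring2-ab-*`, verbatim): research route, not a corollary; conditional on HC_CM plus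
one named minimal statement. (Cell `pub-hodge-ring2`, verbatim: research route conditional on HC_CM; not a corollary;
Q11.4-sentence-2 already refuted in dim ≥ 3.) `HC_CM`, `HC_AV` and the global nodes do NOT occur in this file. No definition,
no named fact, no `sorry`; ABELIAN-VARIETY level (no pencil); the only inputs are tree theorems. Seat `pub-hodge-ring2-ab-andre-2`,
gen 47 (part Q). Input: part Q-a (`exists_hasWeilDiscriminantNondeg_prodCurve_weights`: the weight-`s` classes of `T = P × E`
have discriminant classes `[s]·δ₀`).

THE POINT. Part P-a (gen 46): with ONE polarization `L` of an even-dimensional `T` the twisted square `(T × T, φ × (−φ), L ⊠ L^{⊗m})`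
has van Geemen class `1` only («no even-dimensional analogue of the André method of part O with product classes»). THIS FILE:
with TWO polarizations of `T = P × E` (`dim P = 2j+1` odd, `E` an elliptic curve, both with `√−d`; diagonal `φ_T = φ_P × ψ`) the
product class `(h_P ⊞ η) ⊠ (h_P ⊞ mη)` has class **`[m]` — EVERY POSITIVE CLASS** (§4). Hence (§5, hypothesis-free) every
polarized component `(2j+2, d, [q])`, `q > 0` — split or NOT — contains the twisted square `E₀^{2j+2} × Ē₀^{2j+2}`
(`E₀ = ℂ/(ℤ + ℤ√−d)`, `T = E₀^{2j+1} × E₀`), of Weil type `(2j+2, d)`, with algebraic Weil plane and the Hodge conjecture in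
every codimension (`Deligne1982.hodgeConjectureFor_powSucc_powSucc`), NOT hyperbolic for the class when `[q] ≠ 1`; with part
O-d (odd half-dimension, negative classes) the PARITY-FREE statement (§6): **every polarized component `(n, d, δ)` with
`sign δ = (−1)ⁿ`, `n ≥ 2`, contains a polarized twisted square of an elliptic power satisfying the Hodge conjecture**, so that the
fact-free chart rows of parts M-d/N/O-c (`weilClassesOf_le_algebraicClasses_forall_of_lefschetzB_of_ellipticPowerTwistedSquareChart`:
`B⋆` of the ONE total space ⟹ the Weil Hodge conjecture for EVERY member) have an unconditional anchor ON EVERY COMPONENT,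
the even non-split ones included (part Q-c reads the pencils).

* §4 **`exists_hasWeilDiscriminantNondeg_twistedSquare_prodCurve_of_pos`** — for every `q > 0` a projective embedding of `T × T`
  whose `K`-symmetrised class for `Φ = φ_T × (−φ_T)` is `pr₁^*h₁ + pr₂^*h_m` (`[q] = [m]`), with a non-degenerate witness of class
  `[1]δ₀ · [m]δ₀ = [q]` (ab-weil-1's `hasWeilDiscriminantNondeg_twistedProd`, even ranks `j+1`, `j+1`) and non-zero top power.
* §5 **`exists_hodge_polarized_weilVariety_of_class_even`** (every `j`, `d ≥ 1`, `q > 0`), **`exists_hodge_nonsplit_weilVariety_of_class_even`**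
  (`[q] ≠ 1`: polarized NON-split), instance `exists_hodge_nonsplit_weilEightfold_gaussian_three` (`(4, ℚ(i), [3])`: a component
  reached by no rung in print — `SplitEightfolds` and R2 are the split class).
* §6 **`exists_hodge_polarized_weilVariety_of_weilSign`** (`n ≥ 2`, `sign [q] = (−1)ⁿ`).

HONEST REMARKS. (1) ab-weil-1's CM tower (`weilClassesComponent_inhabited_of_weilSign_eq`, gen 8) already INHABITS every
right-sign component and its `cmTowerAnchor` rows make the tower members valid anchors FOR THE WEIL CLASSES; what is added here
is the twisted-square SHAPE `T × T̄` with the Hodge conjecture for ALL of `T × T̄` on the EVEN NON-split components, in the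
form consumed by the André-axis chart rows. (2) No case of the Hodge conjecture beyond the tree's (powers of a CM elliptic
curve; Weil classes of twisted squares) is claimed; the general member of a non-split component is untouched; «non-split» is
the POLARIZED notion (fixed class) — absolutely, every twisted square with `dim T ≥ 2` is split (part P-a); nothing minimal is
claimed; N104 untouched.

## References

* [vanGeemen1994HodgeAV] B. van Geemen, LNM 1594 (1994), 4.9–4.11, 4.14, Lemma 5.2 (1)–(4), 5.3–5.4 and (5.4.1), Thm. 4.3.
* [Markman2025SurveySecant] E. Markman, arXiv:2509.23403 (unrefereed), §11.5 Step 2.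
* [Hartshorne1977] R. Hartshorne, Algebraic Geometry (1977), II Ex. 5.11–5.12.
* [Deligne1982HodgeCycles] P. Deligne (notes by J. Milne), LNM 900 (1982), §4 Prop. 4.4, Remark 4.10.
* [Landherr1936HermitianForms] W. Landherr, Abh. Math. Sem. Hamburg 11 (1936). [Serre1973] J.-P. Serre, Ch. III §1.
* [Andre1996Motifs] Y. André, Publ. Math. IHÉS 83 (1996), §6.3 Lemme 6.3.3 and Remarque 2 (p. 33).
-/

set_option linter.dupNamespace false

noncomputable section

open CategoryTheory MonoidalCategory AlgebraicGeometry CartesianMonoidalCategory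
open Literature.AlgebraicGeometry Literature.AlgebraicGeometry.Motives
open Literature.AlgebraicGeometry.Motives.SegreHyperplaneClass
open Literature.AlgebraicGeometry.HodgeTheory Literature.AlgebraicGeometry.VanGeemen1994
open Literature.AlgebraicTopology.SingularHomology
open Literature.Geometry.Kaehler

namespace Summit.HodgeConjecture.HodgeConjecture.Ring2.AbelianAll


/-! ## §4 The twisted square of `T = P × E` polarized by `(h_P ⊞ η) ⊠ (h_P ⊞ mη)`: every POSITIVE class -/

section TwistedSquare

variable {P E : AbelianVariety ℂ} {φP : P ⟶ P} {ψ : E ⟶ E} {j d : ℕ}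

/-- **THE EVEN TWISTED SQUARES REACH EVERY POSITIVE CLASS.** Let `T = P × E` with `dim P = 2j + 1`, `dim E = 1`,
`φ_P² = −d`, `ψ² = −d` (`d ≥ 1`), `φ_T = φ_P × ψ`, and let `Φ = φ_T × (−φ_T)` on `T × T`. For every POSITIVE `q ∈ ℚˣ` there is a
projective embedding `e` of `T × T` with a non-zero rational ambient class `a` whose `K`-symmetrised class `d·e^*a + Φ^*e^*a` —
equal to `pr₁^*h₁ + pr₂^*h_m` for the weight-`1` and weight-`m` classes of §3, `[q] = [m]` — carries a NON-DEGENERATE discriminant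
witness of class **`[q]`** (`[1]δ₀ · [m]δ₀ = [m]`: «`det H` of the twisted product is `δ_A δ_B`», ab-weil-1's
`hasWeilDiscriminantNondeg_twistedProd` in the even ranks `j+1`, `j+1`; `(−φ_T)^* = φ_T^*` on `H²`) and has non-zero top power. Contrast
part P-a: with ONE polarization on both factors only the class `1` occurs. [cite: vanGeemen1994HodgeAV, Lemma 5.2 (2)–(3), 4.14 and 5.3]
[cite: Markman2025SurveySecant, §11.5 Step 2] [cite: Hartshorne1977, II Ex. 5.11 and Ex. 5.12] -/
theorem exists_hasWeilDiscriminantNondeg_twistedSquare_prodCurve_of_pos (hP : P.dim = 2 * j + 1) (hE : E.dim = 0 + 1)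
    (hd : 0 < d) (hφP : φP ≫ φP = -(d • 𝟙 P)) (hψ : ψ ≫ ψ = -(d • 𝟙 E)) (q : ℚˣ) (hq : 0 < (q : ℚ)) :
    ∃ (e : ProjectiveEmbedding ((P.prod E).prod (P.prod E)).X) (a : complexBetti (projectiveSpace e.n ℂ) 2),
      IsRationalClass a ∧ a ≠ 0 ∧
      HasWeilDiscriminantNondeg ((P.prod E).prod (P.prod E))
          (AbelianVariety.prodLift
            (AbelianVariety.fst (P.prod E) (P.prod E) ≫
              AbelianVariety.prodLift (AbelianVariety.fst P E ≫ φP) (AbelianVariety.snd P E ≫ ψ))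
            (AbelianVariety.snd (P.prod E) (P.prod E) ≫
              (-AbelianVariety.prodLift (AbelianVariety.fst P E ≫ φP) (AbelianVariety.snd P E ≫ ψ))))
          (2 * j + 2) d
          ((d : ℂ) • complexBetti.map e.ι 2 a +
            complexBetti.map (AbelianVariety.prodLift
              (AbelianVariety.fst (P.prod E) (P.prod E) ≫
                AbelianVariety.prodLift (AbelianVariety.fst P E ≫ φP) (AbelianVariety.snd P E ≫ ψ))
              (AbelianVariety.snd (P.prod E) (P.prod E) ≫
                (-AbelianVariety.prodLift (AbelianVariety.fst P E ≫ φP) (AbelianVariety.snd P E ≫ ψ)))).hom.hom.hom 2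
              (complexBetti.map e.ι 2 a))
          (QuotientGroup.mk q) ∧
      lefschetzPow ((d : ℂ) • complexBetti.map e.ι 2 a +
            complexBetti.map (AbelianVariety.prodLift
              (AbelianVariety.fst (P.prod E) (P.prod E) ≫
                AbelianVariety.prodLift (AbelianVariety.fst P E ≫ φP) (AbelianVariety.snd P E ≫ ψ))
              (AbelianVariety.snd (P.prod E) (P.prod E) ≫
                (-AbelianVariety.prodLift (AbelianVariety.fst P E ≫ φP) (AbelianVariety.snd P E ≫ ψ)))).hom.hom.hom 2
              (complexBetti.map e.ι 2 a)) (2 * (2 * j + 2) - 1) 2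
          ((d : ℂ) • complexBetti.map e.ι 2 a +
            complexBetti.map (AbelianVariety.prodLift
              (AbelianVariety.fst (P.prod E) (P.prod E) ≫
                AbelianVariety.prodLift (AbelianVariety.fst P E ≫ φP) (AbelianVariety.snd P E ≫ ψ))
              (AbelianVariety.snd (P.prod E) (P.prod E) ≫
                (-AbelianVariety.prodLift (AbelianVariety.fst P E ≫ φP) (AbelianVariety.snd P E ≫ ψ)))).hom.hom.hom 2
              (complexBetti.map e.ι 2 a)) ≠ 0 := by
  classical
  set ΦT := AbelianVariety.prodLift (AbelianVariety.fst P E ≫ φP) (AbelianVariety.snd P E ≫ ψ) with hΦT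
  obtain ⟨g, hgr, hgnz, hgσ⟩ := exists_segreHyperplaneClasses
  obtain ⟨N, ιP, hN, hιP⟩ := exists_closedImmersion_projectiveSpace_pos P
  obtain ⟨M, ιE, hM, hιE⟩ := exists_closedImmersion_projectiveSpace_pos E
  obtain ⟨δ₀, hall⟩ := exists_hasWeilDiscriminantNondeg_prodCurve_weights g hgr hgnz hgσ hP hE hd hφP hψ ⟨N, ιP, hιP⟩ hN
    ⟨M, ιE, hιE⟩ hM
  obtain ⟨m, hm, hmq⟩ := exists_nat_mk_eq_of_pos (d := d) q hq
  obtain ⟨e₁, -, -, hW₁, ht₁⟩ := hall 1 one_pos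
  obtain ⟨e₂, he₂n, -, hW₂, ht₂⟩ := hall m hm
  have hT : (P.prod E).dim = 2 * (j + 1) := by rw [AbelianVariety.dim_prod, hP, hE]; ring
  obtain ⟨hW, htop⟩ := hasWeilDiscriminantNondeg_twistedProd (nA := j + 1) (nB := j + 1) (by omega) (by omega) hT hT
    (isRationalClass_ksymm d ΦT e₁ (hgr _)) (isRationalClass_ksymm d ΦT e₂ (hgr _)) ht₁ ht₂ hW₁ hW₂
  -- the class `[1]δ₀ · [m]δ₀ = [m] = [q]`
  have h1 : (Units.mk0 ((1 : ℕ) : ℚ) (Nat.cast_ne_zero.2 one_pos.ne') : ℚˣ) = 1 := Units.ext (by simp)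
  have hcl : (QuotientGroup.mk (Units.mk0 ((1 : ℕ) : ℚ) (Nat.cast_ne_zero.2 one_pos.ne')) : weilNormResidueGroup d) * δ₀ *
      (QuotientGroup.mk (Units.mk0 ((m : ℕ) : ℚ) (Nat.cast_ne_zero.2 hm.ne')) * δ₀) = QuotientGroup.mk q := by
    rw [h1, QuotientGroup.mk_one, one_mul, hmq, mul_comm (QuotientGroup.mk q) δ₀, ← mul_assoc,
      weilNormResidueGroup_mul_self, one_mul]
  rw [hcl] at hW
  -- the Segre embedding of `T × T` with class `pr₁^*(e₁^*g) + pr₂^*(e₂^*g)` and its `K`-symmetrisation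
  obtain ⟨e, hen, he⟩ := exists_projectiveEmbedding_prod g hgσ e₁ e₂
  have hK : (d : ℂ) • complexBetti.map e.ι 2 (g e.n) +
      complexBetti.map (AbelianVariety.prodLift (AbelianVariety.fst (P.prod E) (P.prod E) ≫ ΦT)
        (AbelianVariety.snd (P.prod E) (P.prod E) ≫ (-ΦT))).hom.hom.hom 2 (complexBetti.map e.ι 2 (g e.n)) =
      complexBetti.map (AbelianVariety.fst (P.prod E) (P.prod E)).hom.hom.hom 2
          ((d : ℂ) • complexBetti.map e₁.ι 2 (g e₁.n) + complexBetti.map ΦT.hom.hom.hom 2 (complexBetti.map e₁.ι 2 (g e₁.n))) +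
        complexBetti.map (AbelianVariety.snd (P.prod E) (P.prod E)).hom.hom.hom 2
          ((d : ℂ) • complexBetti.map e₂.ι 2 (g e₂.n) + complexBetti.map ΦT.hom.hom.hom 2 (complexBetti.map e₂.ι 2 (g e₂.n))) := by
    rw [he, smul_add_map_prodLift ΦT (-ΦT) (d : ℂ), map_neg_two]
  refine ⟨e, g e.n, hgr _, hgnz _ (le_trans he₂n hen), ?_, ?_⟩
  · rw [hK, show 2 * j + 2 = j + 1 + (j + 1) by ring]
    exact hW
  · rw [hK, show 2 * (2 * j + 2) - 1 = 2 * (j + 1 + (j + 1)) - 1 by omega]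
    exact htop

end TwistedSquare

/-! ## §5 Every positive class is realised by a polarized `E₀^{2j+2} × Ē₀^{2j+2}` satisfying the Hodge conjecture -/

section Inhabitants

/-- **EVERY POLARIZED COMPONENT `(2j+2, d, [q])`, `q > 0`, CONTAINS A WEIL VARIETY SATISFYING THE HODGE CONJECTURE OUTRIGHT**
(hypothesis-free; the even companion of part O-d's `exists_hodge_polarized_weilVariety_of_class`): an abelian variety `A` —
the twisted square `E₀^{2j+2} × Ē₀^{2j+2}` of `T = E₀^{2j+1} × E₀`, `E₀ = ℂ/(ℤ + ℤ√−d)`, with the diagonal structure —, `φ` with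
`φ² = −d`, a projective embedding `e` and a rational ambient `a ≠ 0` with `dim A = 2(2j+2)`, `(A, φ)` of Weil type `(2j+2, d)`
(part O-a), `K`-symmetrised class `d·e^*a + φ^*e^*a` of non-degenerate discriminant class `[q]` (§4: `(h_P ⊞ η) ⊠ (h_P ⊞ mη)`,
`[q] = [m]`), algebraic Weil plane (the tree's `weilClassesOf_twistedSquare_le_algebraicClasses`) and the Hodge conjecture in
every codimension (`Deligne1982.hodgeConjectureFor_powSucc_powSucc`: `A = (E₀.powSucc (2j+1)).powSucc 1`). In particular every
EVEN NON-split component (`[q] ≠ 1`) has an unconditional André anchor of twisted-square shape.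
[cite: vanGeemen1994HodgeAV, 4.11, 4.14, 5.3 and Thm. 4.3] [cite: Deligne1982HodgeCycles, §4 Prop. 4.4 and Remark 4.10] -/
theorem exists_hodge_polarized_weilVariety_of_class_even (j d : ℕ) (hd : 0 < d) (q : ℚˣ) (hq : 0 < (q : ℚ)) :
    ∃ (A : AbelianVariety ℂ) (φ : A ⟶ A) (e : ProjectiveEmbedding A.X) (a : complexBetti (projectiveSpace e.n ℂ) 2),
      IsRationalClass a ∧ a ≠ 0 ∧ A.dim = 2 * (2 * j + 2) ∧ φ ≫ φ = -(d • 𝟙 A) ∧ IsWeilType A φ (2 * j + 2) d ∧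
      HasWeilDiscriminantNondeg A φ (2 * j + 2) d
        ((d : ℂ) • complexBetti.map e.ι 2 a + complexBetti.map φ.hom.hom.hom 2 (complexBetti.map e.ι 2 a)) (QuotientGroup.mk q) ∧
      weilClassesOf A φ (2 * j + 2) d ≤ algebraicClasses A.X (2 * j + 2) ∧ HodgeConjectureFor A.dim A.X := by
  obtain ⟨E₀, ψ₀, hE, hψ⟩ := Literature.NumberTheory.EllipticCurves.CMEndomorphism.exists_cmCurve_sqrt_neg d hd
  obtain ⟨φP, hφP⟩ := exists_sq_eq_neg_powSucc ψ₀ hψ (2 * j)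
  have hP : (E₀.powSucc (2 * j)).dim = 2 * j + 1 := by rw [dim_powSucc', hE, mul_one]
  have hE' : E₀.dim = 0 + 1 := hE
  obtain ⟨e, a, ha, ha0, hδ, -⟩ := exists_hasWeilDiscriminantNondeg_twistedSquare_prodCurve_of_pos hP hE' hd hφP hψ q hq
  have hT : (E₀.powSucc (2 * j + 1)).dim = 2 * j + 2 := by rw [dim_powSucc', hE]; ring
  have hφT : (AbelianVariety.prodLift (AbelianVariety.fst (E₀.powSucc (2 * j)) E₀ ≫ φP)
        (AbelianVariety.snd (E₀.powSucc (2 * j)) E₀ ≫ ψ₀) : E₀.powSucc (2 * j + 1) ⟶ E₀.powSucc (2 * j + 1)) ≫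
      AbelianVariety.prodLift (AbelianVariety.fst (E₀.powSucc (2 * j)) E₀ ≫ φP)
        (AbelianVariety.snd (E₀.powSucc (2 * j)) E₀ ≫ ψ₀) = -(d • 𝟙 (E₀.powSucc (2 * j + 1))) :=
    prodLift_comp_self_eq_neg hφP hψ
  exact ⟨(E₀.powSucc (2 * j + 1)).prod (E₀.powSucc (2 * j + 1)), _, e, a, ha, ha0, dim_twistedSquare hT,
    twistedSquare_comp_self hφT, isWeilType_twistedSquare (by omega) hT hd hφT, hδ,
    weilClassesOf_twistedSquare_le_algebraicClasses (by omega) hT hd hφT,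
    Deligne1982.hodgeConjectureFor_powSucc_powSucc hE (2 * j + 1) 1⟩

/-- **… and is NOT hyperbolic for that class when `[q] ≠ 1`** (polarized NON-split: van Geemen (5.4.1) contrapositive on the
carriers, `1 = [(−1)^{2j+2}]`). So every EVEN non-split component `(2j+2, d, δ)`, `δ > 0`, `δ ≠ 1`, contains a polarized non-split
Weil `(4j+4)`-fold `E₀^{2j+2} × Ē₀^{2j+2}` satisfying the Hodge conjecture — the even companion of part O-d §3.
[cite: vanGeemen1994HodgeAV, 4.14, 5.3–5.4 and (5.4.1)] [cite: Landherr1936HermitianForms] [cite: Deligne1982HodgeCycles, §4 Remark 4.10] -/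
theorem exists_hodge_nonsplit_weilVariety_of_class_even (j d : ℕ) (hd : 0 < d) (q : ℚˣ) (hq : 0 < (q : ℚ))
    (hne : (QuotientGroup.mk q : weilNormResidueGroup d) ≠ 1) :
    ∃ (A : AbelianVariety ℂ) (φ : A ⟶ A) (e : ProjectiveEmbedding A.X) (a : complexBetti (projectiveSpace e.n ℂ) 2),
      IsRationalClass a ∧ a ≠ 0 ∧ A.dim = 2 * (2 * j + 2) ∧ φ ≫ φ = -(d • 𝟙 A) ∧ IsWeilType A φ (2 * j + 2) d ∧
      HasWeilDiscriminantNondeg A φ (2 * j + 2) d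
        ((d : ℂ) • complexBetti.map e.ι 2 a + complexBetti.map φ.hom.hom.hom 2 (complexBetti.map e.ι 2 a)) (QuotientGroup.mk q) ∧
      ¬ IsHyperbolicWeilType A φ (2 * j + 2)
        ((d : ℂ) • complexBetti.map e.ι 2 a + complexBetti.map φ.hom.hom.hom 2 (complexBetti.map e.ι 2 a)) ∧
      weilClassesOf A φ (2 * j + 2) d ≤ algebraicClasses A.X (2 * j + 2) ∧ HodgeConjectureFor A.dim A.X := by
  obtain ⟨A, φ, e, a, ha, ha0, hdim, hφ, hW, hδ, hWalg, hHC⟩ := exists_hodge_polarized_weilVariety_of_class_even j d hd q hq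
  refine ⟨A, φ, e, a, ha, ha0, hdim, hφ, hW, hδ, ?_, hWalg, hHC⟩
  refine not_isHyperbolicWeilType_of_hasWeilDiscriminantNondeg_ne (by omega) hdim hd hφ e ha ha0 hδ ?_
  rwa [weilNormResidueGroup_mk_neg_one_pow_even]

/-- **Instance: `K = ℚ(i)`, EIGHTFOLDS, the non-split component `(4, 1, [3])`** (`3` is inert in `ℚ(i)`, so `[3] ≠ 1`): a polarized
non-split Weil eightfold `E₀⁴ × Ē₀⁴` of class `[3]` satisfying the Hodge conjecture — an unconditional André anchor on a component
reached by NO rung of the ladder in print (`SplitEightfolds` / R2 are the split class). [cite: Serre1973, Ch. III §1]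
[cite: vanGeemen1994HodgeAV, 4.14 and (5.4.1)] [cite: Deligne1982HodgeCycles, §4 Remark 4.10] -/
theorem exists_hodge_nonsplit_weilEightfold_gaussian_three :
    ∃ (A : AbelianVariety ℂ) (φ : A ⟶ A) (e : ProjectiveEmbedding A.X) (a : complexBetti (projectiveSpace e.n ℂ) 2),
      IsRationalClass a ∧ a ≠ 0 ∧ A.dim = 2 * (2 * 1 + 2) ∧ φ ≫ φ = -((1 : ℕ) • 𝟙 A) ∧ IsWeilType A φ (2 * 1 + 2) 1 ∧
      HasWeilDiscriminantNondeg A φ (2 * 1 + 2) 1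
        (((1 : ℕ) : ℂ) • complexBetti.map e.ι 2 a + complexBetti.map φ.hom.hom.hom 2 (complexBetti.map e.ι 2 a))
        (QuotientGroup.mk (Units.mk0 ((3 : ℕ) : ℚ) (by norm_num))) ∧
      ¬ IsHyperbolicWeilType A φ (2 * 1 + 2)
        (((1 : ℕ) : ℂ) • complexBetti.map e.ι 2 a + complexBetti.map φ.hom.hom.hom 2 (complexBetti.map e.ι 2 a)) ∧
      weilClassesOf A φ (2 * 1 + 2) 1 ≤ algebraicClasses A.X (2 * 1 + 2) ∧ HodgeConjectureFor A.dim A.X := by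
  refine exists_hodge_nonsplit_weilVariety_of_class_even 1 1 one_pos _ (by norm_num) ?_
  rw [Ne, QuotientGroup.eq_one_iff]
  exact WeilCoverage.natCast_not_mem_normUnitsSubgroup_of_inert (d := 1) (a := 3) (p := 3) Nat.prime_three (by decide)
    (dvd_refl 3) (by norm_num) (by norm_num)

end Inhabitants

/-! ## §6 Parity-free: every right-sign polarized component, `n ≥ 2`, contains a polarized twisted square satisfying HC -/

section AllParities

/-- **EVERY POLARIZED COMPONENT `(n, d, δ)` OF THE IMAGINARY-QUADRATIC WEIL TOWER WITH `sign δ = (−1)ⁿ` (`n ≥ 2`, `d ≥ 1`) CONTAINS A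
POLARIZED TWISTED SQUARE OF AN ELLIPTIC POWER SATISFYING THE HODGE CONJECTURE** — odd `n = 2k+1`: part O-d (`E₀^{2k+1} × Ē₀^{2k+1}`,
`L ⊠ L^{⊗m}`, `δ = [−m]`); even `n = 2j+2`: §5 (`E₀^{2j+2} × Ē₀^{2j+2}`, `(h_P ⊞ η) ⊠ (h_P ⊞ mη)`, `δ = [m]`). So on EVERY component the
chart rows of parts M-d/N/O-c (`…_of_ellipticPowerTwistedSquareChart`: `B⋆` of the total space of a compact pencil with its `K`-action
through a chart `K`-isogenous to the anchor ⟹ the Weil Hodge conjecture for every member, fact-free) have an anchor available; the wrong-sign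
components are empty (ab-weil-1's `weilClassesComponent_inhabited_iff_sign`). [cite: vanGeemen1994HodgeAV, 4.11, 4.14, Lemma 5.2 (4) and 5.3]
[cite: Deligne1982HodgeCycles, §4 Prop. 4.4 and Remark 4.10] [cite: Andre1996Motifs, §6.3 Lemme 6.3.3 and Remarque 2 (p. 33)] -/
theorem exists_hodge_polarized_weilVariety_of_weilSign {n d : ℕ} (hn : 2 ≤ n) (hd : 0 < d) (q : ℚˣ)
    (hq : weilSign d (QuotientGroup.mk q) = (-1) ^ n) :
    ∃ (A : AbelianVariety ℂ) (φ : A ⟶ A) (e : ProjectiveEmbedding A.X) (a : complexBetti (projectiveSpace e.n ℂ) 2),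
      IsRationalClass a ∧ a ≠ 0 ∧ A.dim = 2 * n ∧ φ ≫ φ = -(d • 𝟙 A) ∧ IsWeilType A φ n d ∧
      HasWeilDiscriminantNondeg A φ n d
        ((d : ℂ) • complexBetti.map e.ι 2 a + complexBetti.map φ.hom.hom.hom 2 (complexBetti.map e.ι 2 a)) (QuotientGroup.mk q) ∧
      weilClassesOf A φ n d ≤ algebraicClasses A.X n ∧ HodgeConjectureFor A.dim A.X := by
  rw [weilSign_mk] at hq
  obtain ⟨k, rfl | rfl⟩ := Nat.even_or_odd' n
  · -- `n = 2k`, `k = j + 1`: positive sign, §5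
    obtain ⟨j, rfl⟩ : ∃ j, k = j + 1 := ⟨k - 1, by omega⟩
    rw [show ((-1 : ℤˣ) ^ (2 * (j + 1) : ℕ)) = 1 from Even.neg_one_pow ⟨j + 1, two_mul _⟩, ratSign_eq_one_iff] at hq
    rw [show 2 * (j + 1) = 2 * j + 2 by ring]
    exact exists_hodge_polarized_weilVariety_of_class_even j d hd q hq
  · -- `n = 2k + 1`, `k ≥ 1`: negative sign, part O-d
    rw [show ((-1 : ℤˣ) ^ (2 * k + 1 : ℕ)) = -1 from Odd.neg_one_pow ⟨k, rfl⟩, ratSign_eq_neg_one_iff] at hq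
    exact exists_hodge_polarized_weilVariety_of_class k d (by omega) hd q hq

end AllParities

end Summit.HodgeConjecture.HodgeConjecture.Ring2.AbelianAll

end
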